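import Summits.Ventures.HSemireg.WedgeHankelSubstitutionDet
import Summits.Ventures.HSemireg.WedgeHankelSubstitutionEigen

/-!
# Venture HSemireg — THE GENERAL LINEAR SUBSTITUTION (2g): THE CHARACTERISTIC POLYNOMIAL OF THE MOMENT MATRIX — `χ(S_c(g)) = Π_{l=0}^{c} (X − a₁^{c−l} a₂^l)` whenever `g` has a fixed
# node `λ₁` in `K` (`a₁ = α + λ₁γ`, `a₂ = δ − λ₁γ` its two eigenvalues on the letters); `S_c` of a diagonal substitution is diagonal; two fixed nodes ⇒ `S_c(g)` is DIAGONALIZABLE as a matrix;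
# one double node ⇒ `(S_c(g) − a^c·1)^{c+1} = 0` (the matrix side of I6 / I8)

HONEST FRAMING. Part of the Lean index of the computation cell `pub-hsemireg` (seat p10 gen 19, Sunday typer «UNIFORM-IN-n»).
LINEAR ALGEBRA of the moment matrices of th-7's sequence vocabulary ONLY: no variety, no cohomology theory, no sheaf, no Ext group, no semiregularity map;
nothing here says that HC / HC_CM / HC_AV holds; no Literature fact is declared or used.  Custodian versions as in `WedgeHankelSiegelIdeal` (1/3) and `WedgeHankelFrameChange`;
the dictionary (`S_c(g) = Sym^c` of the substitution; its eigenvalues are the monomials `a₁^{c−l}a₂^l` in the eigenvalues of `g`) is QUOTED, never asserted.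

WHAT IS IN THE TREE.  H7 `sbMat` (`S_c(g)`); I1 `WedgeHankelSubstitutionDet` (941): `sbMat_comp` (`S_c(g·g′) = S_c(g′)·S_c(g)`), lower substitutions have UPPER-triangular `S_c` with diagonal
`α^{c−l}δ^l` (`sbMat_lower_blockTriangular`, `sbMat_lower_apply_self`), `det_sbMat_shear = 1`, `det_sbMat`; I4 `WedgeHankelSubstitutionEigen` (945): `sbSeq_diag`; I6 / I8 (class side): two
fixed nodes ⇒ an eigenbasis of the class space, one double node ⇒ one eigen-line.  Mathlib: `Matrix.charpoly_of_upperTriangular`, `Matrix.charpoly_mul_comm`, `Matrix.aeval_self_charpoly`.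
THIS FILE is the matrix side (namespace `Summit.Ventures.HSemireg.Wedge.HankelFrameChange` continued):
* §186 **`sbMat_diag`: `S_c(a 0 0 d) = diagonal(a^{c−l} d^l)`**; `trace_sbMat_lower` (`tr S_c(α 0 γ δ) = Σ_l α^{c−l}δ^l`); **`charpoly_sbMat_lower`: `χ(S_c(α 0 γ δ)) = Π_l (X − C(α^{c−l}δ^l))`**;
  `charpoly_sbMat_shear` (`(X − 1)^{c+1}`), **`sbMat_shear_sub_one_pow`: `(S_c(1 λ 0 1) − 1)^{c+1} = 0`** (the Pascal matrix is unipotent; Cayley–Hamilton).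
* §187 ONE FIXED NODE `λ₁` (`β + λ₁δ = λ₁(α+λ₁γ)`): **`sbMat_mul_eq_of_fixed_one`: `S_c(g)·S_c(1 λ₁ 0 1) = S_c(1 λ₁ 0 1)·S_c(α+λ₁γ, 0, γ, δ−λ₁γ)`** (the 2×2 identity `h·g = g′·h` through
  `sbMat_comp`), `sbMat_eq_conj_of_fixed_one` (`P = S_c(1 λ₁ 0 1)` has `det 1`), **`charpoly_sbMat_of_fixed_one`: `χ(S_c(g)) = Π_l (X − C((α+λ₁γ)^{c−l}(δ−λ₁γ)^l))`**, `trace_sbMat_of_fixed_one`.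
* §188 THE PARABOLIC CASE (`δ − λ₁γ = α + λ₁γ =: a`): `charpoly_sbMat_of_parabolic` (`(X − C(a^c))^{c+1}`), **`sbMat_sub_pow_eq_zero_of_parabolic`: `(S_c(g) − a^c·1)^{c+1} = 0`**.
* §189 TWO FIXED NODES `λ₁ ≠ λ₂`: `sbMat_mul_eq_of_fixed_two`, **`sbMat_eq_conj_diag_of_fixed_two`: `S_c(g) = P · diagonal((α+λ₁γ)^{c−l}(α+λ₂γ)^l) · P⁻¹`**, `P = S_c(1 λ₁ 1 λ₂)`
  (`det P = (λ₂−λ₁)^{c(c+1)/2} ≠ 0`) — `S_c(g)` IS DIAGONALIZABLE AS A MATRIX (I6 on the matrix side).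
NOT typed here: `χ(S_c(g))` when `g` has NO fixed node in `K` (irreducible characteristic polynomial of `g`: the same product over the two conjugate eigenvalues, needs a splitting field);
minimal polynomials; anything class- or Ext-side.  New names only.
-/

open Module
open scoped Matrix

namespace Summit.Ventures.HSemireg.Wedge.HankelFrameChange

open Summit.Ventures.HSemireg.Wedge Summit.Ventures.HSemireg.Wedge.Hankel

variable (K : Type*) [Field K]

/-! ## §186. Diagonal substitutions, the shear, and the characteristic polynomial of a lower substitution -/

/-- **`S_c(a 0 0 d) = diagonal(a^{c−l} d^l)`** (I4 `sbSeq_diag` on spikes). -/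
theorem sbMat_diag (a d : K) (c : ℕ) : sbMat K a 0 0 d c (c + 1) = Matrix.diagonal fun l : Fin (c + 1) => a ^ (c - (l : ℕ)) * d ^ (l : ℕ) := by
  ext i l
  rw [sbMat_apply, sbSeq_diag K a d c _ (show (i : ℕ) ≤ c by have := i.2; omega), Matrix.diagonal_apply]
  by_cases h : i = l
  · subst h; rw [if_pos rfl, if_pos rfl, mul_one]
  · rw [if_neg (fun e => h (Fin.ext e)), if_neg h, mul_zero]

/-- the trace of a lower substitution's moment matrix: `tr S_c(α 0 γ δ) = Σ_l α^{c−l} δ^l`. -/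
theorem trace_sbMat_lower (α γ δ : K) (c : ℕ) : (sbMat K α 0 γ δ c (c + 1)).trace = ∑ l : Fin (c + 1), α ^ (c - (l : ℕ)) * δ ^ (l : ℕ) := by
  rw [Matrix.trace]
  exact Finset.sum_congr rfl fun l _ => by rw [Matrix.diag_apply, sbMat_lower_apply_self]

/-- **THE CHARACTERISTIC POLYNOMIAL OF A LOWER SUBSTITUTION: `χ(S_c(α 0 γ δ)) = Π_l (X − C(α^{c−l}δ^l))`** (upper triangular, I1). -/
theorem charpoly_sbMat_lower (α γ δ : K) (c : ℕ) : (sbMat K α 0 γ δ c (c + 1)).charpoly = ∏ l : Fin (c + 1), (Polynomial.X - Polynomial.C (α ^ (c - (l : ℕ)) * δ ^ (l : ℕ))) := by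
  rw [Matrix.charpoly_of_upperTriangular _ (sbMat_lower_blockTriangular K α γ δ c)]
  exact Finset.prod_congr rfl fun l _ => by rw [sbMat_lower_apply_self]

/-- **`χ(S_c(1 λ 0 1)) = (X − 1)^{c+1}`**: the shear is the swap-conjugate of the LOWER shear, `(1,λ,0,1) = (0,1,1,0)·(1,0,λ,1)·(0,1,1,0)` as substitutions, so `S_c(1 λ 0 1) = W·S_c(1 0 λ 1)·W` with
`W = S_c(0 1 1 0)`, `W² = 1` (`sbMat_comp`), and `charpoly_mul_comm` reduces to §186's triangular case. -/
theorem charpoly_sbMat_shear (lam : K) (c : ℕ) : (sbMat K 1 lam 0 1 c (c + 1)).charpoly = (Polynomial.X - Polynomial.C 1) ^ (c + 1) := by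
  -- `(1,λ,0,1) = w · (1,0,λ,1) · w` with `w = (0,1,1,0)`, `w·w = 1`
  have e1 : sbMat K 1 lam 0 1 c (c + 1) = sbMat K 0 1 1 0 c (c + 1) * (sbMat K 1 0 lam 1 c (c + 1) * sbMat K 0 1 1 0 c (c + 1)) := by
    rw [← sbMat_comp, ← sbMat_comp]; congr 1 <;> ring
  have e2 : sbMat K 0 1 1 0 c (c + 1) * sbMat K 0 1 1 0 c (c + 1) = 1 := by
    rw [← sbMat_comp, ← sbMat_one K c]; congr 1 <;> ring
  rw [e1, Matrix.charpoly_mul_comm, mul_assoc, e2, mul_one, charpoly_sbMat_lower]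
  simp only [one_pow, mul_one, Finset.prod_const, Finset.card_univ, Fintype.card_fin]

/-- **THE PASCAL MATRIX IS UNIPOTENT: `(S_c(1 λ 0 1) − 1)^{c+1} = 0`** (Cayley–Hamilton). -/
theorem sbMat_shear_sub_one_pow (lam : K) (c : ℕ) : (sbMat K 1 lam 0 1 c (c + 1) - 1) ^ (c + 1) = 0 := by
  have h := Matrix.aeval_self_charpoly (sbMat K 1 lam 0 1 c (c + 1))
  rwa [charpoly_sbMat_shear, map_pow, map_sub, Polynomial.aeval_X, Polynomial.aeval_C, map_one] at h

/-! ## §187. One fixed node: conjugate to a lower substitution -/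

/-- **`S_c(g)·S_c(1 λ₁ 0 1) = S_c(1 λ₁ 0 1)·S_c(α+λ₁γ, 0, γ, δ−λ₁γ)`** when `λ₁` is a fixed node (`β + λ₁δ = λ₁(α + λ₁γ)`): the `2 × 2` identity `h·g = g′·h`, `h = (1, λ₁, 0, 1)`, pushed through
`sbMat_comp`. -/
theorem sbMat_mul_eq_of_fixed_one {α β γ δ l₁ : K} (e₁ : β + l₁ * δ = l₁ * (α + l₁ * γ)) (c : ℕ) :
    sbMat K α β γ δ c (c + 1) * sbMat K 1 l₁ 0 1 c (c + 1) = sbMat K 1 l₁ 0 1 c (c + 1) * sbMat K (α + l₁ * γ) 0 γ (δ - l₁ * γ) c (c + 1) := by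
  rw [← sbMat_comp, ← sbMat_comp]
  congr 1
  · ring
  · linear_combination e₁
  · ring
  · ring

/-- the frame matrix `P = S_c(1 λ₁ 0 1)` is invertible (`det P = 1`). -/
lemma isUnit_det_sbMat_shear (lam : K) (c : ℕ) : IsUnit (sbMat K 1 lam 0 1 c (c + 1)).det := by
  rw [det_sbMat_shear]; exact isUnit_one

/-- **`S_c(g) = P · S_c(α+λ₁γ, 0, γ, δ−λ₁γ) · P⁻¹`, `P = S_c(1 λ₁ 0 1)`** (one fixed node). -/
theorem sbMat_eq_conj_of_fixed_one {α β γ δ l₁ : K} (e₁ : β + l₁ * δ = l₁ * (α + l₁ * γ)) (c : ℕ) :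
    sbMat K α β γ δ c (c + 1) = sbMat K 1 l₁ 0 1 c (c + 1) * sbMat K (α + l₁ * γ) 0 γ (δ - l₁ * γ) c (c + 1) * (sbMat K 1 l₁ 0 1 c (c + 1))⁻¹ := by
  rw [← sbMat_mul_eq_of_fixed_one K e₁ c, Matrix.mul_nonsing_inv_cancel_right _ _ (isUnit_det_sbMat_shear K l₁ c)]

/-- **THE CHARACTERISTIC POLYNOMIAL OF `S_c(g)` FOR A SUBSTITUTION WITH A FIXED NODE `λ₁ ∈ K`: `χ(S_c(g)) = Π_{l=0}^{c} (X − C((α+λ₁γ)^{c−l}(δ−λ₁γ)^l))`** — the eigenvalues of `Sym^c(g)` are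
the monomials in the two eigenvalues `α + λ₁γ`, `δ − λ₁γ` of `g` on the letters (dictionary quoted). -/
theorem charpoly_sbMat_of_fixed_one {α β γ δ l₁ : K} (e₁ : β + l₁ * δ = l₁ * (α + l₁ * γ)) (c : ℕ) :
    (sbMat K α β γ δ c (c + 1)).charpoly = ∏ l : Fin (c + 1), (Polynomial.X - Polynomial.C ((α + l₁ * γ) ^ (c - (l : ℕ)) * (δ - l₁ * γ) ^ (l : ℕ))) := by
  rw [sbMat_eq_conj_of_fixed_one K e₁ c, mul_assoc, Matrix.charpoly_mul_comm, mul_assoc, Matrix.nonsing_inv_mul _ (isUnit_det_sbMat_shear K l₁ c), mul_one,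
    charpoly_sbMat_lower]

/-- the trace: `tr S_c(g) = Σ_l (α+λ₁γ)^{c−l}(δ−λ₁γ)^l` (one fixed node). -/
theorem trace_sbMat_of_fixed_one {α β γ δ l₁ : K} (e₁ : β + l₁ * δ = l₁ * (α + l₁ * γ)) (c : ℕ) :
    (sbMat K α β γ δ c (c + 1)).trace = ∑ l : Fin (c + 1), (α + l₁ * γ) ^ (c - (l : ℕ)) * (δ - l₁ * γ) ^ (l : ℕ) := by
  rw [sbMat_eq_conj_of_fixed_one K e₁ c, mul_assoc, Matrix.trace_mul_comm, mul_assoc, Matrix.nonsing_inv_mul _ (isUnit_det_sbMat_shear K l₁ c), mul_one, trace_sbMat_lower]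

/-! ## §188. The parabolic case: a single eigenvalue -/

/-- a DOUBLE fixed node (`δ − λ₁γ = α + λ₁γ =: a`): `χ(S_c(g)) = (X − C(a^c))^{c+1}`. -/
theorem charpoly_sbMat_of_parabolic {α β γ δ l₁ : K} (e₁ : β + l₁ * δ = l₁ * (α + l₁ * γ)) (hpar : δ - l₁ * γ = α + l₁ * γ) (c : ℕ) :
    (sbMat K α β γ δ c (c + 1)).charpoly = (Polynomial.X - Polynomial.C ((α + l₁ * γ) ^ c)) ^ (c + 1) := by
  rw [charpoly_sbMat_of_fixed_one K e₁ c, hpar]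
  have e : ∀ l : Fin (c + 1), (α + l₁ * γ) ^ (c - (l : ℕ)) * (α + l₁ * γ) ^ (l : ℕ) = (α + l₁ * γ) ^ c := fun l => by
    rw [← pow_add, Nat.sub_add_cancel (show (l : ℕ) ≤ c by have := l.2; omega)]
  simp only [e, Finset.prod_const, Finset.card_univ, Fintype.card_fin]

/-- **`(S_c(g) − a^c·1)^{c+1} = 0` for a DOUBLE fixed node** (`a = α + λ₁γ = δ − λ₁γ`; Cayley–Hamilton) — the matrix side of I8's «one eigen-line». -/
theorem sbMat_sub_pow_eq_zero_of_parabolic {α β γ δ l₁ : K} (e₁ : β + l₁ * δ = l₁ * (α + l₁ * γ)) (hpar : δ - l₁ * γ = α + l₁ * γ) (c : ℕ) :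
    (sbMat K α β γ δ c (c + 1) - Matrix.scalar (Fin (c + 1)) ((α + l₁ * γ) ^ c)) ^ (c + 1) = 0 := by
  have h := Matrix.aeval_self_charpoly (sbMat K α β γ δ c (c + 1))
  rwa [charpoly_sbMat_of_parabolic K e₁ hpar, map_pow, map_sub, Polynomial.aeval_X, Polynomial.aeval_C] at h

/-! ## §189. Two fixed nodes: diagonalizable as a matrix -/

/-- **`S_c(g)·S_c(1 λ₁ 1 λ₂) = S_c(1 λ₁ 1 λ₂)·S_c(α+λ₁γ, 0, 0, α+λ₂γ)`** for two fixed nodes (`β + λ_iδ = λ_i(α + λ_iγ)`, `i = 1, 2`; I6's identity through `sbMat_comp`). -/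
theorem sbMat_mul_eq_of_fixed_two {α β γ δ l₁ l₂ : K} (e₁ : β + l₁ * δ = l₁ * (α + l₁ * γ)) (e₂ : β + l₂ * δ = l₂ * (α + l₂ * γ)) (c : ℕ) :
    sbMat K α β γ δ c (c + 1) * sbMat K 1 l₁ 1 l₂ c (c + 1) = sbMat K 1 l₁ 1 l₂ c (c + 1) * sbMat K (α + l₁ * γ) 0 0 (α + l₂ * γ) c (c + 1) := by
  rw [← sbMat_comp, ← sbMat_comp]
  congr 1
  · ring
  · linear_combination e₁
  · ring
  · linear_combination e₂

/-- the two-node frame matrix is invertible for `λ₁ ≠ λ₂` (`det = (λ₂ − λ₁)^{c(c+1)/2}`, I1). -/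
lemma isUnit_det_sbMat_frame {l₁ l₂ : K} (h₁₂ : l₁ ≠ l₂) (c : ℕ) : IsUnit (sbMat K 1 l₁ 1 l₂ c (c + 1)).det := by
  rw [det_sbMat, isUnit_iff_ne_zero]
  exact pow_ne_zero _ (by rw [one_mul, mul_one]; exact sub_ne_zero.mpr (Ne.symm h₁₂))

/-- **`S_c(g)` IS DIAGONALIZABLE AS A MATRIX for two distinct fixed nodes: `S_c(g) = P · diagonal((α+λ₁γ)^{c−l}(α+λ₂γ)^l) · P⁻¹`, `P = S_c(1 λ₁ 1 λ₂)`.** -/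
theorem sbMat_eq_conj_diag_of_fixed_two {α β γ δ l₁ l₂ : K} (h₁₂ : l₁ ≠ l₂) (e₁ : β + l₁ * δ = l₁ * (α + l₁ * γ)) (e₂ : β + l₂ * δ = l₂ * (α + l₂ * γ)) (c : ℕ) :
    sbMat K α β γ δ c (c + 1) =
      sbMat K 1 l₁ 1 l₂ c (c + 1) * Matrix.diagonal (fun l : Fin (c + 1) => (α + l₁ * γ) ^ (c - (l : ℕ)) * (α + l₂ * γ) ^ (l : ℕ)) * (sbMat K 1 l₁ 1 l₂ c (c + 1))⁻¹ := by
  rw [← sbMat_diag, ← sbMat_mul_eq_of_fixed_two K e₁ e₂ c, Matrix.mul_nonsing_inv_cancel_right _ _ (isUnit_det_sbMat_frame K h₁₂ c)]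

/-- and then `χ(S_c(g)) = Π_l (X − C((α+λ₁γ)^{c−l}(α+λ₂γ)^l))` (also a case of §187, with `δ − λ₁γ = α + λ₂γ` by I4 `mobius_fixed_two_iff`). -/
theorem charpoly_sbMat_of_fixed_two {α β γ δ l₁ l₂ : K} (h₁₂ : l₁ ≠ l₂) (e₁ : β + l₁ * δ = l₁ * (α + l₁ * γ)) (e₂ : β + l₂ * δ = l₂ * (α + l₂ * γ)) (c : ℕ) :
    (sbMat K α β γ δ c (c + 1)).charpoly = ∏ l : Fin (c + 1), (Polynomial.X - Polynomial.C ((α + l₁ * γ) ^ (c - (l : ℕ)) * (α + l₂ * γ) ^ (l : ℕ))) := by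
  have d : δ - l₁ * γ = α + l₂ * γ := by
    have := ((mobius_fixed_two_iff h₁₂).mp ⟨e₁, e₂⟩).1
    rw [this]; ring
  rw [charpoly_sbMat_of_fixed_one K e₁ c, d]

end Summit.Ventures.HSemireg.Wedge.HankelFrameChange
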